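/-
Copyright (c) 2026 the pub-hodgecm-mathlib formalisation cell (harness21).  Prover seat hodgecm-mathlib-K2Liu-p07 (g2): Track B «K2-LIT»,
#184♮ = hLiu418 = stmt-HodgeConjecture-24832; LEAD F0P6-plan (g10) DEAL 2026-09-03T23:43:04Z «B2»; REPORT-FIRST B2 6770f1399d2dee2a, file B2b; 2026-09-04.
-/
import Summits.HodgeConjecture.HodgeConjecture.Theorems.K2LiuSiegelBruhatMiddleCell
import Summits.HodgeConjecture.HodgeConjecture.Theorems.K2LiuSiegelBigCellFree
import HarnessLib

/-!
# Crux `HLiu418`, road `K2_Liu`, organ O41.1 part B2 (file B2b): the reflection elements `w_g = ι(1, g)` of `H(𝔸)` for an INVOLUTION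
# `g ∈ G₁` — D9 lift of ★ B2a: rationality, the frame `(1 0; G − 1, G)`, the stabiliser `N_g` («corner condition»), cosets and orbits

Cell `hodgecm-mathlib`, crux item hLiu418 = `stmt-HodgeConjecture-24832`; prover K2Liu-p07 (g2).  THEOREMS ONLY (no `def`, no instance, no notation,
no `sorry`); imports ★ B2a `K2LiuSiegelBruhatMiddleCell` (frames) + ★ (a) `K2LiuSiegelBigCellFree` (hence ★ D9); lane
`--supports stmt-HodgeConjecture-24832 --as helper`.

THE ELEMENTS.  For `g ∈ G₁(𝔸) = U(V ⊗ W)(𝔸)` (★ `adelicPair`), `w_g := ι(1, g) ∈ H(𝔸)` (★ D9∕`DoublingEmbedding.iotaGG`); `G := reindex e g` its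
`n × n` adelic matrix.  If `g` is an INVOLUTION (`g² = 1`) then `E := ⅟2(1 − G)` is idempotent and the frame of `w_g` is ★ B2a's reflection frame
`W_E = (1, 0; −2E, 1 − 2E) = (1, 0; G − 1, G)`; the cell of `w_g` is `rank(1 − G)`: `g = −1` gives the big cell (`w_{−1} = w_Δ`, ★ D9), `g = 1`
the identity, and a rank-one reflection (n = 2: `g = diag(1, −1)`, a rational unitary sign matrix for the diagonal `dV ⊗ dW`) the MIDDLE cell.
* §1 `iotaGG_one_eq_inlG` (`ι(x,1) = inlG x`), **`iotaGG_one_mem_ratH`**: `w_g ∈ H(L⁺)` for RATIONAL `g` (`ι(1,g) = ι(g,g)·ι(g⁻¹,1)`, ★ `diagG_rational`,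
  ★ `inlG_rational`) — so the cosets `[w_g p]`, `p ∈ P_Δ(L⁺)`, are points of ★ `SiegelDeltaQuot`.
* §2 `blk_iotaGG_one` (`blk w_g = diag(1, G)`), `frame_iotaGG_one` (`E₁·blk w_g·E₂ = (1, 0; G − 1, G)`), `iotaGG_one_mul_self` (`w_g² = 1` for `g² = 1`),
  `reindex_mul_self` (`G² = 1`).
* §3 **`isSiegelDelta_conj_unip_iff`**: for an involution `g` and `u ∈ N_Δ(𝔸)` with corner `X = (blk u)₁₂`:
  **`w_g u w_g ∈ P_Δ(𝔸) ⟺ (1 − G) X (1 − G) = 0`** (★ B2a `reflConj_unip_siegel_iff` with `E = ⅟2(1 − G)`) — the stabiliser `N_g = N_Δ ∩ w_g⁻¹P_Δ w_g`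
  of the coset `P_Δ w_g` under the right `N_Δ`-action (for `G = diag(1, −1)`: `X₂₂ = 0`); `not_isSiegelDelta_iotaGG_one` (`G ≠ 1 ⇒ w_g ∉ P_Δ`).
* §4 COSETS: **`mk_eq_mk_iff_isSiegelDelta`** (`[a] = [b]` in `P_Δ(L⁺)\H(L⁺)` iff `b a⁻¹ ∈ P_Δ`) and the STABILISER of a translate:
  **`mk_mul_eq_mk_iff`**: for `γ ∈ H(L⁺)` and `ν ∈ N_Δ(L⁺)`, `[γ ν] = [γ] ⟺ γ ν γ⁻¹ ∈ P_Δ` — with §3 (γ = w_g p, `p ν p⁻¹ ∈ N_Δ`) this is the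
  corner condition on `p ν p⁻¹`: `Stab_{N_Δ(L⁺)}([w_g p]) = p⁻¹ N_g(L⁺) p` (REPORT-FIRST B2 (C3)).
Consumers: O41.4 v2 (MID as a sum over the `w_g`-orbits with these stabilisers), O41.8.  NOT here: the exhaustion «`rank C = 1 ⇒ P_Δ w_g P_Δ`» (B2c).
[GelbartPiatetskishapiroRallis1987, Part A §§1–2], [KudlaRallis1994, §1], [MoeglinWaldspurger1995, II.1.7].
HONEST LABEL.  Count-neutral helper; `HC_CM` is proved only modulo the 7 printed citations (hLiu418 = 24832, h413 = 24833) until rung 0 closes.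
-/

set_option autoImplicit false
set_option linter.dupNamespace false -- the mandated namespace repeats `HodgeConjecture.HodgeConjecture`

noncomputable section

open scoped Matrix
open NumberField IsDedekindDomain
open Literature.NumberTheory.Automorphic Literature.NumberTheory.GaloisRepresentations
open Literature.NumberTheory.GelbartRogawski1991 Literature.NumberTheory.GelbartRogawski1991.GRConstruction
open Literature.NumberTheory.K2Lit.SiegelDoubled

namespace Summit.HodgeConjecture.HodgeConjecture.Cruxes.HLiu418.K2LiuSiegelBruhatMiddleCellDelta

open K2LiuSiegelBruhatMiddleCell K2LiuSiegelBigCellFree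

variable (L : Type) [Field L] [NumberField L] [IsCMField L]
variable {N M n : ℕ} (e : Fin N × Fin M ≃ Fin n)
  (dV : Fin N → L) (hdV : ∀ i, IsCMField.complexConj L (dV i) = dV i)
  (dW : Fin M → L) (hdW : ∀ i, IsCMField.complexConj L (dW i) = dW i)

/-! ## §1 `ι(1, g)` is rational for rational `g` -/

/-- `ι(x, 1) = inlG x` (both have the `GL`-matrix `reindex e₂ (diag(reindex e x, 1))`; cf. ★ `K2LiuDoublingUnfoldOrbit.iotaGG_inl_one` for `M = 1`).
[cite: GelbartPiatetskishapiroRallis1987, Part A §1] -/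
theorem iotaGG_one_eq_inlG (x : UnitaryGroup.adelicPair (Fp L) L (IsCMField.complexConj L) N M (Matrix.diagonal dV) (Matrix.diagonal dW)) :
    iotaGG L e dV hdV dW hdW (x, 1) = inlG L e dV hdV dW hdW x := by
  apply Subtype.ext
  rw [coe_iotaGG, coe_inlG]
  simp only [OneMemClass.coe_one, map_one]

/-- `ι(1, g) = ι(g, g) · ι(g⁻¹, 1) = diagG g · inlG g⁻¹`. [cite: GelbartPiatetskishapiroRallis1987, Part A §1] -/
theorem iotaGG_one_left_eq (g : UnitaryGroup.adelicPair (Fp L) L (IsCMField.complexConj L) N M (Matrix.diagonal dV) (Matrix.diagonal dW)) :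
    iotaGG L e dV hdV dW hdW (1, g) = diagG L e dV hdV dW hdW g * inlG L e dV hdV dW hdW g⁻¹ := by
  rw [← iotaGG_diag, ← iotaGG_one_eq_inlG, ← map_mul, Prod.mk_mul_mk, mul_inv_cancel, mul_one]

/-- **`w_g = ι(1, g) ∈ H(L⁺)` for rational `g`** (`g = γ ⊗ 1`, `γ ∈ G₁(L⁺)`): ★ `diagG_rational`, ★ `inlG_rational`.
[cite: GelbartPiatetskishapiroRallis1987, Part A §1] -/
theorem iotaGG_one_mem_ratH (γ : UnitaryGroup.rationalPair (Fp L) L (IsCMField.complexConj L) N M (Matrix.diagonal dV) (Matrix.diagonal dW)) :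
    iotaGG L e dV hdV dW hdW (1, UnitaryGroup.rationalPairToAdelic (Fp L) L (IsCMField.complexConj L) N M (Matrix.diagonal dV) (Matrix.diagonal dW) γ) ∈
      ratH L e dV hdV dW hdW := by
  rw [iotaGG_one_left_eq]
  exact mul_mem (diagG_rational L e dV hdV dW hdW _ ⟨γ, rfl⟩) (inlG_rational L e dV hdV dW hdW _ ⟨γ⁻¹, by rw [map_inv]⟩)

/-! ## §2 The block matrix and the frame of `w_g`; involutions -/

/-- **`blk ι(1, g) = diag(1, G)`**, `G = reindex e g`. [cite: GelbartPiatetskishapiroRallis1987, Part A §1] -/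
theorem blk_iotaGG_one (g : UnitaryGroup.adelicPair (Fp L) L (IsCMField.complexConj L) N M (Matrix.diagonal dV) (Matrix.diagonal dW)) :
    blk L e dV hdV dW hdW (iotaGG L e dV hdV dW hdW (1, g)) =
      Matrix.fromBlocks 1 0 0 (Matrix.reindex e e ((g : GL (Fin N × Fin M) (AdeleRing (𝓞 L) L)) : Matrix (Fin N × Fin M) (Fin N × Fin M) (AdeleRing (𝓞 L) L))) := by
  rw [blk_iotaGG_eq]
  simp only [OneMemClass.coe_one, Units.val_one, Matrix.reindex_apply, Matrix.submatrix_one_equiv]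

/-- **The frame of `w_g`: `E₁ · blk ι(1, g) · E₂ = (1, 0; G − 1, G)`** (★ `conjE_eq`) — p02's sketch «frame `(1 0; g − 1, g)`».
[cite: GelbartPiatetskishapiroRallis1987, Part A §1] -/
theorem frame_iotaGG_one (g : UnitaryGroup.adelicPair (Fp L) L (IsCMField.complexConj L) N M (Matrix.diagonal dV) (Matrix.diagonal dW)) :
    Matrix.fromBlocks (1 : Matrix (Fin n) (Fin n) (AdeleRing (𝓞 L) L)) 0 (-1) 1 * blk L e dV hdV dW hdW (iotaGG L e dV hdV dW hdW (1, g)) *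
        Matrix.fromBlocks 1 0 1 1 =
      Matrix.fromBlocks 1 0 (Matrix.reindex e e ((g : GL (Fin N × Fin M) (AdeleRing (𝓞 L) L)) : Matrix (Fin N × Fin M) (Fin N × Fin M) (AdeleRing (𝓞 L) L)) - 1)
        (Matrix.reindex e e ((g : GL (Fin N × Fin M) (AdeleRing (𝓞 L) L)) : Matrix (Fin N × Fin M) (Fin N × Fin M) (AdeleRing (𝓞 L) L))) := by
  rw [blk_iotaGG_one, conjE_eq, Matrix.toBlocks_fromBlocks₁₁, Matrix.toBlocks_fromBlocks₁₂, Matrix.toBlocks_fromBlocks₂₁, Matrix.toBlocks_fromBlocks₂₂,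
    add_zero, zero_add, sub_zero]

/-- `(reindex e g)² = 1` for an involution `g² = 1`. [folklore] -/
theorem reindex_mul_self {g : UnitaryGroup.adelicPair (Fp L) L (IsCMField.complexConj L) N M (Matrix.diagonal dV) (Matrix.diagonal dW)} (hg : g * g = 1) :
    Matrix.reindex e e ((g : GL (Fin N × Fin M) (AdeleRing (𝓞 L) L)) : Matrix (Fin N × Fin M) (Fin N × Fin M) (AdeleRing (𝓞 L) L)) *
        Matrix.reindex e e ((g : GL (Fin N × Fin M) (AdeleRing (𝓞 L) L)) : Matrix (Fin N × Fin M) (Fin N × Fin M) (AdeleRing (𝓞 L) L)) = 1 := by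
  have h : ((g : GL (Fin N × Fin M) (AdeleRing (𝓞 L) L)) : Matrix (Fin N × Fin M) (Fin N × Fin M) (AdeleRing (𝓞 L) L)) *
      ((g : GL (Fin N × Fin M) (AdeleRing (𝓞 L) L)) : Matrix (Fin N × Fin M) (Fin N × Fin M) (AdeleRing (𝓞 L) L)) = 1 := by
    rw [← Units.val_mul, ← Subgroup.coe_mul, hg, OneMemClass.coe_one, Units.val_one]
  rw [Matrix.reindex_apply, Matrix.submatrix_mul_equiv, h, Matrix.submatrix_one_equiv]

/-- **`w_g² = 1`** for an involution `g`. [cite: GelbartPiatetskishapiroRallis1987, Part A §1] -/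
theorem iotaGG_one_mul_self {g : UnitaryGroup.adelicPair (Fp L) L (IsCMField.complexConj L) N M (Matrix.diagonal dV) (Matrix.diagonal dW)} (hg : g * g = 1) :
    iotaGG L e dV hdV dW hdW (1, g) * iotaGG L e dV hdV dW hdW (1, g) = 1 := by
  rw [← map_mul, Prod.mk_mul_mk, mul_one, hg, ← Prod.one_eq_mk, map_one]

/-- The idempotent of an involution: `E = ⅟2 (1 − G)` satisfies `E² = E` when `G² = 1`, and `G − 1 = −2E`, `G = 1 − 2E`. [folklore] -/
theorem idem_of_involution {R : Type*} [CommRing R] [Invertible (2 : R)] {m : Type*} [Fintype m] [DecidableEq m] {G : Matrix m m R} (hG : G * G = 1) :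
    ((⅟ (2 : R)) • (1 - G)) * ((⅟ (2 : R)) • (1 - G)) = (⅟ (2 : R)) • (1 - G) ∧
      G - 1 = -((2 : R) • ((⅟ (2 : R)) • (1 - G))) ∧ G = 1 - (2 : R) • ((⅟ (2 : R)) • (1 - G)) := by
  refine ⟨?_, ?_, ?_⟩
  · rw [Matrix.smul_mul, Matrix.mul_smul, smul_smul, Matrix.sub_mul, Matrix.mul_sub, Matrix.mul_sub, Matrix.one_mul, Matrix.mul_one,
      Matrix.one_mul, hG]
    have h : (1 - G - (G - 1) : Matrix m m R) = (2 : R) • (1 - G) := by module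
    rw [h, smul_smul, mul_assoc, invOf_mul_self, mul_one]
  · rw [smul_smul, mul_invOf_self, one_smul, neg_sub]
  · rw [smul_smul, mul_invOf_self, one_smul, sub_sub_cancel]

/-! ## §3 The stabiliser `N_g`: the corner condition at the level of `H(𝔸)` -/

/-- **`w_g · u · w_g ∈ P_Δ(𝔸) ⟺ (1 − G) X (1 − G) = 0`** for an involution `g ∈ G₁(𝔸)`, `u ∈ N_Δ(𝔸)` with corner `X = (blk u)₁₂`, `G = reindex e g`
(★ `isSiegelDelta_iff_conj`, ★ `conj_blk_mul`, ★ D9 `mem_unipDelta_iff_conj`, ★ B2a `reflConj_unip_siegel_iff` with `E = ⅟2(1 − G)`).  This is the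
stabiliser `N_g = N_Δ ∩ w_g⁻¹ P_Δ w_g` (`w_g⁻¹ = w_g`) of the coset `P_Δ w_g` under right multiplication by `N_Δ`; for the rank-one sign involution
`G = diag(1, −1)` (n = 2) the condition reads `X₂₂ = 0`. [cite: MoeglinWaldspurger1995, II.1.7] [cite: GelbartPiatetskishapiroRallis1987, Part A §§1–2] -/
theorem isSiegelDelta_conj_unip_iff {g : UnitaryGroup.adelicPair (Fp L) L (IsCMField.complexConj L) N M (Matrix.diagonal dV) (Matrix.diagonal dW)}
    (hg : g * g = 1) {u : HA L e dV hdV dW hdW} (hu : u ∈ unipDelta L e dV hdV dW hdW) :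
    IsSiegelDelta L e dV hdV dW hdW (iotaGG L e dV hdV dW hdW (1, g) * u * iotaGG L e dV hdV dW hdW (1, g)) ↔
      (1 - Matrix.reindex e e ((g : GL (Fin N × Fin M) (AdeleRing (𝓞 L) L)) : Matrix (Fin N × Fin M) (Fin N × Fin M) (AdeleRing (𝓞 L) L))) *
          (blk L e dV hdV dW hdW u).toBlocks₁₂ *
        (1 - Matrix.reindex e e ((g : GL (Fin N × Fin M) (AdeleRing (𝓞 L) L)) : Matrix (Fin N × Fin M) (Fin N × Fin M) (AdeleRing (𝓞 L) L))) = 0 := by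
  set G : Matrix (Fin n) (Fin n) (AdeleRing (𝓞 L) L) :=
    Matrix.reindex e e ((g : GL (Fin N × Fin M) (AdeleRing (𝓞 L) L)) : Matrix (Fin N × Fin M) (Fin N × Fin M) (AdeleRing (𝓞 L) L)) with hGdef
  obtain ⟨hE, hG1, hG2⟩ := idem_of_involution (reindex_mul_self L e dV dW hg)
  have hframe : Matrix.fromBlocks (1 : Matrix (Fin n) (Fin n) (AdeleRing (𝓞 L) L)) 0 (-1) 1 * blk L e dV hdV dW hdW (iotaGG L e dV hdV dW hdW (1, g)) *
      Matrix.fromBlocks 1 0 1 1 =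
        Matrix.fromBlocks 1 0 (-((2 : AdeleRing (𝓞 L) L) • ((⅟ (2 : AdeleRing (𝓞 L) L)) • (1 - G)))) (1 - (2 : AdeleRing (𝓞 L) L) • ((⅟ (2 : AdeleRing (𝓞 L) L)) • (1 - G))) := by
    rw [frame_iotaGG_one, ← hGdef, ← hG1, ← hG2]
  rw [isSiegelDelta_iff_conj, conj_blk_mul, conj_blk_mul, hframe, (mem_unipDelta_iff_conj L e dV hdV dW hdW u).1 hu,
    reflConj_unip_siegel_iff hE]
  -- `E X E = 0 ⟺ (1 − G) X (1 − G) = 0`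
  rw [Matrix.smul_mul, Matrix.smul_mul, Matrix.mul_smul, smul_smul]
  constructor
  · intro h
    have h' : ((2 : AdeleRing (𝓞 L) L) * 2) • ((⅟ (2 : AdeleRing (𝓞 L) L) * ⅟ (2 : AdeleRing (𝓞 L) L)) • ((1 - G) * (blk L e dV hdV dW hdW u).toBlocks₁₂ * (1 - G))) = 0 := by
      rw [h, smul_zero]
    rwa [smul_smul, show (2 : AdeleRing (𝓞 L) L) * 2 * (⅟ (2 : AdeleRing (𝓞 L) L) * ⅟ (2 : AdeleRing (𝓞 L) L)) = 1 by
      rw [mul_assoc, ← mul_assoc (2 : AdeleRing (𝓞 L) L) (⅟ 2), mul_invOf_self, one_mul, mul_invOf_self], one_smul] at h'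
  · intro h
    rw [h, smul_zero]

/-- **`w_g ∉ P_Δ(𝔸)` as soon as `G ≠ 1`** (its frame corner is `G − 1`). [cite: GelbartPiatetskishapiroRallis1987, Part A §1] -/
theorem not_isSiegelDelta_iotaGG_one {g : UnitaryGroup.adelicPair (Fp L) L (IsCMField.complexConj L) N M (Matrix.diagonal dV) (Matrix.diagonal dW)}
    (hG : Matrix.reindex e e ((g : GL (Fin N × Fin M) (AdeleRing (𝓞 L) L)) : Matrix (Fin N × Fin M) (Fin N × Fin M) (AdeleRing (𝓞 L) L)) ≠ 1) :
    ¬ IsSiegelDelta L e dV hdV dW hdW (iotaGG L e dV hdV dW hdW (1, g)) := by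
  rw [isSiegelDelta_iff_conj, frame_iotaGG_one, Matrix.toBlocks_fromBlocks₂₁, sub_eq_zero]
  exact hG

/-! ## §4 Cosets of `P_Δ(L⁺)\H(L⁺)`: equality and stabilisers under right multiplication -/

variable {L e dV hdV dW hdW}

/-- **`[a] = [b]` in `P_Δ(L⁺)\H(L⁺)` iff `b a⁻¹ ∈ P_Δ`** (★ `SiegelDeltaQuot` = orbits of the left `P_Δ(L⁺)`-action; rationality of `b a⁻¹` is automatic).
[cite: Garrett2018, §3.10] -/
theorem mk_eq_mk_iff_isSiegelDelta (a b : ratH L e dV hdV dW hdW) :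
    (Quotient.mk (MulAction.orbitRel (siegelDeltaRat L e dV hdV dW hdW) (ratH L e dV hdV dW hdW)) a : SiegelDeltaQuot L e dV hdV dW hdW) =
        Quotient.mk (MulAction.orbitRel (siegelDeltaRat L e dV hdV dW hdW) (ratH L e dV hdV dW hdW)) b ↔
      IsSiegelDelta L e dV hdV dW hdW (((b : ratH L e dV hdV dW hdW) : HA L e dV hdV dW hdW) * ((a : ratH L e dV hdV dW hdW) : HA L e dV hdV dW hdW)⁻¹) := by
  constructor
  · intro h
    have hrel : MulAction.orbitRel (siegelDeltaRat L e dV hdV dW hdW) (ratH L e dV hdV dW hdW) a b := Quotient.exact h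
    obtain ⟨p, hp⟩ := MulAction.mem_orbit_iff.1 (MulAction.orbitRel_apply.1 hrel)
    have hpS : IsSiegelDelta L e dV hdV dW hdW ((p : ratH L e dV hdV dW hdW) : HA L e dV hdV dW hdW) :=
      (mem_siegelDelta_iff L e dV hdV dW hdW _).1 (Subgroup.mem_subgroupOf.1 p.2)
    -- `a = p • b`, so `b a⁻¹ = p⁻¹`
    have hval : ((a : ratH L e dV hdV dW hdW) : HA L e dV hdV dW hdW) = ((p : ratH L e dV hdV dW hdW) : HA L e dV hdV dW hdW) * (b : HA L e dV hdV dW hdW) := by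
      rw [← hp]; rfl
    rw [hval, mul_inv_rev, mul_inv_cancel_left]
    exact isSiegelDelta_inv L e dV hdV dW hdW hpS
  · intro h
    -- `q := b a⁻¹ ∈ P_Δ(L⁺)` and `q⁻¹ • b = a`
    refine Quotient.sound (MulAction.orbitRel_apply.2 (MulAction.mem_orbit_iff.2 ⟨⟨(b * a⁻¹)⁻¹, Subgroup.mem_subgroupOf.2 ?_⟩, ?_⟩))
    · exact (mem_siegelDelta_iff L e dV hdV dW hdW _).2 (isSiegelDelta_inv L e dV hdV dW hdW h)
    · apply Subtype.ext
      change (((b * a⁻¹)⁻¹ * b : ratH L e dV hdV dW hdW) : HA L e dV hdV dW hdW) = a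
      rw [mul_inv_rev, inv_inv, mul_assoc, inv_mul_cancel, mul_one]

/-- **Stabiliser of a coset under right multiplication**: for `γ, ν ∈ H(L⁺)`, `[γ ν] = [γ] ⟺ γ ν γ⁻¹ ∈ P_Δ`.  With §3 (`γ = w_g p`, `p ∈ P_Δ(L⁺)`,
`ν ∈ N_Δ(L⁺)`, so `p ν p⁻¹ ∈ N_Δ` and `w_g⁻¹ = w_g`): `Stab_{N_Δ(L⁺)}([w_g p]) = p⁻¹ N_g(L⁺) p` — the stabiliser datum of REPORT-FIRST B2 (C3).
[cite: MoeglinWaldspurger1995, II.1.7] -/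
theorem mk_mul_eq_mk_iff (γ ν : ratH L e dV hdV dW hdW) :
    (Quotient.mk (MulAction.orbitRel (siegelDeltaRat L e dV hdV dW hdW) (ratH L e dV hdV dW hdW)) (γ * ν) : SiegelDeltaQuot L e dV hdV dW hdW) =
        Quotient.mk (MulAction.orbitRel (siegelDeltaRat L e dV hdV dW hdW) (ratH L e dV hdV dW hdW)) γ ↔
      IsSiegelDelta L e dV hdV dW hdW ((γ : HA L e dV hdV dW hdW) * (ν : HA L e dV hdV dW hdW) * ((γ : HA L e dV hdV dW hdW))⁻¹) := by
  rw [mk_eq_mk_iff_isSiegelDelta]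
  -- `γ (γν)⁻¹ = γ ν⁻¹ γ⁻¹ ∈ P_Δ ⟺ its inverse γ ν γ⁻¹ ∈ P_Δ`
  have hinv : ((γ : HA L e dV hdV dW hdW) * (((γ * ν : ratH L e dV hdV dW hdW) : HA L e dV hdV dW hdW))⁻¹) =
      ((γ : HA L e dV hdV dW hdW) * (ν : HA L e dV hdV dW hdW) * ((γ : HA L e dV hdV dW hdW))⁻¹)⁻¹ := by
    rw [Subgroup.coe_mul, mul_inv_rev, mul_inv_rev, mul_inv_rev, inv_inv]
  rw [hinv]
  exact ⟨fun h => by simpa using isSiegelDelta_inv L e dV hdV dW hdW h, fun h => isSiegelDelta_inv L e dV hdV dW hdW h⟩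

/-- **Two translates of `w_g` by `P_Δ(L⁺)` give the same coset iff they differ by `w_g P_Δ w_g⁻¹ ∩ P_Δ`**: for `p, p' ∈ H(L⁺)`,
`[w_g p'] = [w_g p] ⟺ w_g p' p⁻¹ w_g⁻¹ ∈ P_Δ` (★ `mk_eq_mk_iff_isSiegelDelta`); combined with the `N_Δ`-stabiliser above this says the right
`N_Δ(L⁺)`-orbits inside the `w_g`-cell are indexed by `(P_Δ ∩ w_g⁻¹P_Δ w_g)(L⁺)·N_Δ(L⁺) \ P_Δ(L⁺)` (= `B_g\M_Δ` once the Levi is named — ★ B2a §4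
`reflConj_leviFrame_siegel_iff`; REPORT-FIRST B2 (C2)). [cite: MoeglinWaldspurger1995, II.1.7] -/
theorem mk_wg_mul_eq_iff (w p p' : ratH L e dV hdV dW hdW) :
    (Quotient.mk (MulAction.orbitRel (siegelDeltaRat L e dV hdV dW hdW) (ratH L e dV hdV dW hdW)) (w * p') : SiegelDeltaQuot L e dV hdV dW hdW) =
        Quotient.mk (MulAction.orbitRel (siegelDeltaRat L e dV hdV dW hdW) (ratH L e dV hdV dW hdW)) (w * p) ↔
      IsSiegelDelta L e dV hdV dW hdW ((w : HA L e dV hdV dW hdW) * ((p : HA L e dV hdV dW hdW) * ((p' : HA L e dV hdV dW hdW))⁻¹) *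
        ((w : HA L e dV hdV dW hdW))⁻¹) := by
  rw [mk_eq_mk_iff_isSiegelDelta, Subgroup.coe_mul, Subgroup.coe_mul, mul_inv_rev, ← mul_assoc, mul_assoc (w : HA L e dV hdV dW hdW)]

end Summit.HodgeConjecture.HodgeConjecture.Cruxes.HLiu418.K2LiuSiegelBruhatMiddleCellDelta

end
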